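import Summits.QuantumFields.BalabanUV.Beta.GAN24.BornBorderLift
import Summits.QuantumFields.BalabanUV.Beta.GAN24.BornLambdaUndressedRow
import Summits.QuantumFields.BalabanUV.Beta.GAN24.BornBorderLineage
import Summits.QuantumFields.BalabanUV.Beta.GAN24.TaylorMassVHAn1At

/-!
# The UNDRESSED one-step image of the V-source ON an1's SYMMETRISED border `symVhSAt` is the one-shot third jet of its lifted table (twin of the OWNER's `BornBorderLift` §3; §1–§2 BY NAME from it)

NOT IN PRINT — OUR BOOKKEEPING (road-P2 = `b2b-balaban-gan24-p2` gen 56, 2026-08-25; row G-an2-4 ∕ (CONV-C), the (α-0) chain at row D1's literal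
OF RECORD (III′) `JsB12CombShSym`; [folklore] composition BY NAME; 0 `def`, 0 cite, 0 `def … : Prop`, 0 `sorry`).  Weight 0.  NEVER «G-an2-4 closed» as (CONV-C);
NOT D1, NOT BetaPertH, NOT continuum, NOT Clay; NO campaign opened (an2 W-4) — a brick of the located `hUv⁰` transfer (road-P2 MEMO M-gan24p2-g56-1 §2(b), M.77's RAW socket).

NAMING: «An1» = an1's (0.4)-SYMMETRISED border table `symVhSAt ρ` (the record field `SymTables.V`); the (E) files' «Sym» = the un-negated rooted `vhSAt ρ`.  METHOD = the OWNER's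
`mkroot.py` rule (road-P2's `tools/mkstab.py`): the (E) file VERBATIM with `vhSAt (toSite r) ↦ symVhSAt (toSite r)` through `TaylorMassVHAn1At ∕ …SymAn1At` (road-P2, this gen);
the table-FREE lemmas of the (E) file are NOT re-declared but opened BY NAME from it; same theorem names in the `…An1` namespace; (E) files untouched.
Discharges NOTHING of (hS, hSall) ∕ hB by itself — it prices the RAW undressed V letter of M.77 (one of the four ROW letters of the (III′) born row, V half).
-/

noncomputable section

open Finset
open scoped BigOperators
open Literature.MathematicalPhysics.QuantumFieldTheory
open Literature.MathematicalPhysics.QuantumFieldTheory.Balaban1983to89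
open Literature.MathematicalPhysics.QuantumFieldTheory.Balaban1983to89.Beta
open ExpKernelCalculus (MKer Decays)
open OneStepResolventKernel (Fib LocStencil KInv decays_KInv)
open OneStepKernelFamily (dec colH KInvStep decays_dec)
open AffineAveraging (box toSite)
open AveragingHessianKernels (ell)
open Summit.QuantumFields.BalabanUV.Beta.SymAveragingHessianCounts (symVhSAt symVhKerAt symVhKerAt_eq_zero_left symVhKerAt_eq_zero_right abs_symVhKerAt_le
  locStencil_symVhSAt symVhSAt_symm)
open StepJetData (locStencil_smul)
open Summit.QuantumFields.BalabanUV.Beta.HessKerDressedUnits (unitK_apply legScale_inr)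
open Summit.QuantumFields.BalabanUV.Beta.GAN24.CombesThomas (sfStep smStep KStepUnit)
open Summit.QuantumFields.BalabanUV.Beta.GAN24.SrecUnits (KStepUnit_eq)
open Summit.QuantumFields.BalabanUV.Beta.GAN24.BornLambdaUndressedRow (e3OfS_smul)
open BalabanCompositeJets (respStep)
open DecLiftAdjoint (borderSum)
open Summit.QuantumFields.BalabanUV.Beta.GAN24.Push4 (rowM IsFF)
open Summit.QuantumFields.BalabanUV.Beta.GAN24.Push3 (push₃)
open Summit.QuantumFields.BalabanUV.Beta.GAN24.Push3LegTelescope (push₃_smul_left push₃_smul_right push₃_smul_table push₃_neg_left)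
open Summit.QuantumFields.BalabanUV.Beta.GAN24.E3UnitSplit (e3OfS)
open Summit.QuantumFields.BalabanUV.Beta.GAN24.ThirdJetKernel (e3K e3OfS_eq_e3K e3K_smul)
open Summit.QuantumFields.BalabanUV.Beta.GAN24.CubicReadoutDecLift (e3K_borderSum)
open Summit.QuantumFields.BalabanUV.Beta.GAN24.SrecLinearPartEq (colM rowMM colM_apply rowMM_apply reslot reslot_inl_inl e3K_eq_neg_sum_push₃ push₃_zero)
open Summit.QuantumFields.BalabanUV.Beta.GAN24.BornLambdaLift (colH_dec_KInv rowM_dec_KInv)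

open Summit.QuantumFields.BalabanUV.Beta.GAN24.BornBorderLift (reslot_inl_inl_eq_zero_of reslot_inr_inr_eq_zero_of mixed_push₃_eq_e3OfS_borderSum colM_KStepUnit rowMM_KStepUnit)

open Summit.QuantumFields.BalabanUV.Beta.GAN24.TaylorMassVHAn1At (symBorderIncAt symVhSAt_inl_inl symVhSAt_inr_inr)

namespace Summit.QuantumFields.BalabanUV.Beta.GAN24.BornBorderLiftAn1

variable {d : ℕ}

/-! ## §1 An off-diagonal family has no diagonal channels -/



/-! ## §2 The mixed-channel lift -/

section Lift

variable {M L N' : ℕ} [NeZero M] [NeZero N']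


end Lift

/-! ## §3 The comb instance: the UNDRESSED one-step image of the V-source is the one-shot third jet of the lifted symmetric border table -/

section Comb

variable {Lc : ℕ} [NeZero Lc]



/-- NOT IN PRINT; OUR BOOKKEEPING ([folklore]; BORNV-PLAN-v0 (V-1)∕(V-U), one step).  **THE UNDRESSED ONE-STEP IMAGE OF THE COMB V-SOURCE IS THE ONE-SHOT THIRD
JET OF THE LIFTED SYMMETRIC BORDER TABLE**: with `V = cVH • vhSAt ρ` (the V-source of EVERY member in its own units, leaf-01's `unitS_freshAt_v`),
`R⁰ = respStep (Lc^i) (Lc^(i+1))`, `K̃_i = KStepUnit Lc i` — leaf-01's `BornBorderLineage.unitStepMap_v_eq_two_push₃` with the dressed one-step response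
`respStepBm ρ Lc (Lc^i) (Lc^(i+1))` REPLACED BY the undressed `R⁰` —
`(cE·Lc^{2(d+1)}) • (−(push₃ (−R⁰) (colM K̃_i Lc) R⁰ (reslot inl inr V) + push₃ (rowMM K̃_i Lc) R⁰ R⁰ (reslot inr inl V)))
 = e3OfS (Lc^(i+1)) ((cE·Lc^{2(d+1)}·(smStep d Lc i)²·(Lc^i)^{d+2}) • borderSum (Lc^i) V)` (in-block root; §2 + the unit legs above).  NOTE: the table is an1's
SYMMETRIC `vhSAt ρ` (the literal (E)), NOT the antisymmetrised `mfNeg`-border of `BalabanCompositeJets.Sc` ∕ `SpineRooted.borderIncAt`. -/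
theorem undressedStepV_eq_e3OfS_borderSum (hLc : 1 ≤ Lc) {rr : Fin (d + 1) → ℕ} (hrr : rr ∈ box (d + 1) Lc) (cE cVH : ℝ) (i : ℕ)
    (κ' : Fin (d + 1)) (u' : Fin (d + 1) → ℤ) :
    (cE * (Lc : ℝ) ^ (2 * (d + 1))) •
        -(push₃ (-respStep (d := d) (Lc ^ i) (Lc ^ (i + 1))) (colM (KStepUnit (d := d) Lc i) Lc) (respStep (d := d) (Lc ^ i) (Lc ^ (i + 1)))
              (reslot Sum.inl Sum.inr fun κ u => cVH • symVhSAt (toSite rr) d Lc rfl κ u) κ' u'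
          + push₃ (rowMM (KStepUnit (d := d) Lc i) Lc) (respStep (d := d) (Lc ^ i) (Lc ^ (i + 1))) (respStep (d := d) (Lc ^ i) (Lc ^ (i + 1)))
              (reslot Sum.inr Sum.inl fun κ u => cVH • symVhSAt (toSite rr) d Lc rfl κ u) κ' u')
      = e3OfS (Lc ^ (i + 1)) (fun κ u => (cE * (Lc : ℝ) ^ (2 * (d + 1)) * (smStep d Lc i) ^ 2 * ((Lc : ℝ) ^ i) ^ (d + 2)) •
          borderSum (Lc ^ i) (fun κ u => cVH • symVhSAt (toSite rr) d Lc rfl κ u) κ u) κ' u' := by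
  -- the source is local (rate 1) and off-diagonal
  have hS : LocStencil (fun κ u => cVH • symVhSAt (toSite rr) d Lc rfl κ u)
      (|cVH| * (3 * (ell (d + 1) Lc : ℝ) ^ 2 * Real.exp (4 * ((d : ℝ) + 1) * Lc * 1))) 1 :=
    locStencil_smul cVH (locStencil_symVhSAt hLc hrr zero_le_one)
  have hff : ∀ κ u x z (α β : Fin (d + 1)), (fun κ u => cVH • symVhSAt (toSite rr) d Lc rfl κ u) κ u x z (Sum.inl α) (Sum.inl β) = 0 :=
    fun κ u x z α β => by simp only [Pi.smul_apply, smul_eq_mul, symVhSAt_inl_inl, mul_zero]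
  have hmm : ∀ κ u x z (μ ν : Fin (d + 1)), (fun κ u => cVH • symVhSAt (toSite rr) d Lc rfl κ u) κ u x z (Sum.inr μ) (Sum.inr ν) = 0 :=
    fun κ u x z μ ν => by simp only [Pi.smul_apply, smul_eq_mul, symVhSAt_inr_inr, mul_zero]
  have hN : Lc ^ (i + 1) = Lc ^ i * Lc := pow_succ Lc i
  have key := mixed_push₃_eq_e3OfS_borderSum (M := Lc ^ i) (L := Lc) hN hS one_pos hff hmm κ' u'
  rw [colM_KStepUnit, rowMM_KStepUnit, push₃_neg_left, push₃_smul_right, push₃_smul_left, Nat.cast_pow] at *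
  rw [show (fun κ u => (cE * (Lc : ℝ) ^ (2 * (d + 1)) * smStep d Lc i ^ 2 * ((Lc : ℝ) ^ i) ^ (d + 2)) •
        borderSum (Lc ^ i) (fun κ u => cVH • symVhSAt (toSite rr) d Lc rfl κ u) κ u)
      = fun κ u => (cE * (Lc : ℝ) ^ (2 * (d + 1)) * smStep d Lc i ^ 2) •
        (fun κ u => (((Lc : ℝ) ^ i) ^ (d + 2)) • borderSum (Lc ^ i) (fun κ u => cVH • symVhSAt (toSite rr) d Lc rfl κ u) κ u) κ u by
      funext κ u; rw [smul_smul], e3OfS_smul, ← key, neg_add, neg_neg, smul_sub, smul_add, smul_neg, smul_smul, smul_smul, sub_eq_add_neg]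

end Comb

end Summit.QuantumFields.BalabanUV.Beta.GAN24.BornBorderLiftAn1

end
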